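import Mathlib
import Summits.Ventures.PercRepro2.HCov
import Summits.Ventures.PercRepro2.HCovCubic
import Summits.Ventures.PercRepro2.TriDisagreement
import Summits.Ventures.PercRepro2.TriDisagreementPinned
import Summits.Ventures.PercRepro2.TypedSplit
import Summits.Ventures.PercRepro2.OneTypedEdge
import Summits.Ventures.PercRepro2.StarPattern
import Summits.Ventures.PercRepro2.StarIdentities
import Summits.Ventures.PercRepro2.StarDebt
import Summits.Ventures.PercRepro2.ChainCoeff
import Summits.Ventures.PercRepro2.StarChain
import Summits.Ventures.PercRepro2.StarPayment

/-!
# The pattern dictionary of the `(2,2,2)` hard step (blind cell PercRepro2, p1 g12; ASSIGNMENTS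
v12.31 (c), the lead's «dictionary of record for the step», mining/lead/g22/tri/ README «27
placement patterns»)

A PLACEMENT `σ = (σ₀, σ₁, σ₂) : Fin 3 × Fin 3 × Fin 3` sends the three pairs `01, 02, 12` of the star
(`pairPat 0/1/2`) to copies; its WEIGHT `W(σ) = patternWeight σ` is the pattern count with each pair
open in its copy (pairs in a common copy merge to `T`). The triangle base is the sum of all 27
weights (`Btriangle_eq_sum_patternWeight`), and the three leaves of the step are the three
sub-sums (pure `Finset.sum` bookkeeping, no inequality):

* `B(T₁) = Σ_{σ constant} W(σ)` (**`btOne_eq_sum_const`**; 3 placements),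
* `E_p = Λ(T;p;∅) = Σ_{σ_q = σ_r ≠ σ_p} W(σ)` (**`chainLeaf_eq_sum_isolating`**; 6 each),
* `A = Λ(01;02;12) = Σ_{σ injective} W(σ)` (**`antiLeaf_eq_sum_distinct`**; 6).

In this vocabulary the candidate rules of the step are one family (`Btriangle_eq`):
`TvT ↔ 0 ≤ A + Σ_p E_p` (**`tvT_iff`**), `Pay222 ↔ ∃ p, 0 ≤ A + E_p` (**`pay222_iff`**),
**`TwoLargest`** `:= ∃ p, 0 ≤ A + E_q + E_r` (`{q, r}` the other two pairs) — THE PAYMENT TARGET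
OF RECORD after NEG-109 (the one-leaf `Pay222` fails with an unmarked end) —
`↔ min_p B(T₁ + p₁) ≤ B(△₁)` (**`twoLargest_iff_min`**), and the chain
`Pay222 ∧ TriCH ⟹ TwoLargest ⟹ TvT ⟹ 0 ≤ N_(2,2,2)` (**`twoLargest_of_pay222_of_triCH`**,
**`tvT_of_twoLargest_of_triCH`**, **`typedCount_222_nonneg_of_twoLargest_of_triCH`**) — the hard
step has one kernel-checked target family in one vocabulary. Definitions and identities only.
-/

namespace Summit.Ventures.PercRepro2

open CovForm CovForm.OneTyped CovForm.TypedRed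

namespace StarPattern

section Dictionary

variable {V : Type*} {E : Type*} [Fintype E] [DecidableEq E] {R : Type*} [Field R]

/-- The placement of a block in copy `c` (the copy pattern with one `true`). -/
def copyPat : Fin 3 → Bool × Bool × Bool :=
  ![(true, false, false), (false, true, false), (false, false, true)]

/-- The three pairs of the star: `pairPat 0 = 01`, `pairPat 1 = 02`, `pairPat 2 = 12`. -/
def pairPat : Fin 3 → Bool × Bool × Bool :=
  ![(true, true, false), (true, false, true), (false, true, true)]

/-- **The placement weight** `W(σ)`: the pattern count with the pair `01` open in copy `σ.1`, `02`
in copy `σ.2.1` and `12` in copy `σ.2.2` (pairs in a common copy merge). -/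
noncomputable def patternWeight (ends : E → Sym2 V) (o a₁ a₂ a₃ b : V) (s₁ s₂ s₃ : E)
    (F₀ : Finset E) (z₀ : Config E) (τ : E → ℕ) (σ : Fin 3 × Fin 3 × Fin 3) : R :=
  patCount ends o a₁ a₂ a₃ b s₁ s₂ s₃ F₀ z₀ τ
    (orU (onCopy (pairPat 0) (copyPat σ.1).1)
      (orU (onCopy (pairPat 1) (copyPat σ.2.1).1) (onCopy (pairPat 2) (copyPat σ.2.2).1)))
    (orU (onCopy (pairPat 0) (copyPat σ.1).2.1)
      (orU (onCopy (pairPat 1) (copyPat σ.2.1).2.1) (onCopy (pairPat 2) (copyPat σ.2.2).2.1)))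
    (orU (onCopy (pairPat 0) (copyPat σ.1).2.2)
      (orU (onCopy (pairPat 1) (copyPat σ.2.1).2.2) (onCopy (pairPat 2) (copyPat σ.2.2).2.2)))

/-- The constant placements (all three pairs in one copy). -/
def constSet : Finset (Fin 3 × Fin 3 × Fin 3) :=
  Finset.univ.filter fun σ => σ.1 = σ.2.1 ∧ σ.2.1 = σ.2.2

/-- The placements isolating the pair `i`: the other two pairs in a common copy, `i` elsewhere. -/
def isolSet : Fin 3 → Finset (Fin 3 × Fin 3 × Fin 3)
  | 0 => Finset.univ.filter fun σ => σ.2.1 = σ.2.2 ∧ σ.1 ≠ σ.2.1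
  | 1 => Finset.univ.filter fun σ => σ.1 = σ.2.2 ∧ σ.2.1 ≠ σ.1
  | 2 => Finset.univ.filter fun σ => σ.1 = σ.2.1 ∧ σ.2.2 ≠ σ.1

/-- The injective placements (three distinct copies). -/
def distinctSet : Finset (Fin 3 × Fin 3 × Fin 3) :=
  Finset.univ.filter fun σ => σ.1 ≠ σ.2.1 ∧ σ.1 ≠ σ.2.2 ∧ σ.2.1 ≠ σ.2.2

/-- The constant placements, explicitly. -/
lemma constSet_eq : constSet = {(0, 0, 0), (1, 1, 1), (2, 2, 2)} := by decide

/-- The placements isolating the pair `01`, explicitly. -/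
lemma isolSet_zero :
    isolSet 0 = {(0, 1, 1), (0, 2, 2), (1, 0, 0), (1, 2, 2), (2, 0, 0), (2, 1, 1)} := by decide

/-- The placements isolating the pair `02`, explicitly. -/
lemma isolSet_one :
    isolSet 1 = {(0, 1, 0), (0, 2, 0), (1, 0, 1), (1, 2, 1), (2, 0, 2), (2, 1, 2)} := by decide

/-- The placements isolating the pair `12`, explicitly. -/
lemma isolSet_two :
    isolSet 2 = {(0, 0, 1), (0, 0, 2), (1, 1, 0), (1, 1, 2), (2, 2, 0), (2, 2, 1)} := by decide

/-- The injective placements, explicitly. -/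
lemma distinctSet_eq :
    distinctSet = {(0, 1, 2), (0, 2, 1), (1, 0, 2), (1, 2, 0), (2, 0, 1), (2, 1, 0)} := by decide

variable (ends : E → Sym2 V) (o a₁ a₂ a₃ b : V) (s₁ s₂ s₃ : E) (F₀ : Finset E) (z₀ : Config E)
  (τ : E → ℕ)

/-- **The triangle base is the sum of the 27 placement weights.** -/
theorem Btriangle_eq_sum_patternWeight :
    Btriangle (R := R) ends o a₁ a₂ a₃ b s₁ s₂ s₃ F₀ z₀ τ =
      ∑ σ : Fin 3 × Fin 3 × Fin 3, patternWeight ends o a₁ a₂ a₃ b s₁ s₂ s₃ F₀ z₀ τ σ := by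
  unfold Btriangle Bindep3 patternWeight
  simp only [sum_placements, Fintype.sum_prod_type, Fin.sum_univ_three, copyPat, pairPat,
    Matrix.cons_val_zero, Matrix.cons_val_one, Matrix.head_cons, Matrix.cons_val_two,
    Matrix.tail_cons]

/-- **`B(T₁)` is the sum over the constant placements.** -/
theorem btOne_eq_sum_const :
    Bone (R := R) ends o a₁ a₂ a₃ b s₁ s₂ s₃ F₀ z₀ τ (true, true, true) =
      ∑ σ ∈ constSet, patternWeight ends o a₁ a₂ a₃ b s₁ s₂ s₃ F₀ z₀ τ σ := by
  rw [constSet_eq, Finset.sum_insert (by decide), Finset.sum_insert (by decide),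
    Finset.sum_singleton]
  unfold patternWeight Bone
  simp only [copyPat, pairPat, Matrix.cons_val_zero, Matrix.cons_val_one, Matrix.head_cons,
    Matrix.cons_val_two, Matrix.tail_cons, onCopy, orU, Bool.and_true, Bool.and_false,
    Bool.or_true, Bool.or_false]
  ring

/-- The chain leaf of the pair `0` is the sum over the placements isolating it. -/
theorem chainLeaf_eq_sum_isolating_zero :
    nestLeaf (R := R) ends o a₁ a₂ a₃ b s₁ s₂ s₃ F₀ z₀ τ (true, true, false) =
      ∑ σ ∈ isolSet 0, patternWeight ends o a₁ a₂ a₃ b s₁ s₂ s₃ F₀ z₀ τ σ := by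
  unfold nestLeaf
  rw [chainCoeff_one_one_one, isolSet_zero, Finset.sum_insert (by decide),
    Finset.sum_insert (by decide), Finset.sum_insert (by decide), Finset.sum_insert (by decide),
    Finset.sum_insert (by decide), Finset.sum_singleton]
  unfold patternWeight
  simp only [copyPat, pairPat, Matrix.cons_val_zero, Matrix.cons_val_one, Matrix.head_cons,
    Matrix.cons_val_two, Matrix.tail_cons, onCopy, orU, Bool.and_true, Bool.and_false,
    Bool.or_true, Bool.or_false]
  ring

/-- The chain leaf of the pair `1` is the sum over the placements isolating it. -/
theorem chainLeaf_eq_sum_isolating_one :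
    nestLeaf (R := R) ends o a₁ a₂ a₃ b s₁ s₂ s₃ F₀ z₀ τ (true, false, true) =
      ∑ σ ∈ isolSet 1, patternWeight ends o a₁ a₂ a₃ b s₁ s₂ s₃ F₀ z₀ τ σ := by
  unfold nestLeaf
  rw [chainCoeff_one_one_one, isolSet_one, Finset.sum_insert (by decide),
    Finset.sum_insert (by decide), Finset.sum_insert (by decide), Finset.sum_insert (by decide),
    Finset.sum_insert (by decide), Finset.sum_singleton]
  unfold patternWeight
  simp only [copyPat, pairPat, Matrix.cons_val_zero, Matrix.cons_val_one, Matrix.head_cons,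
    Matrix.cons_val_two, Matrix.tail_cons, onCopy, orU, Bool.and_true, Bool.and_false,
    Bool.or_true, Bool.or_false]
  ring

/-- The chain leaf of the pair `2` is the sum over the placements isolating it. -/
theorem chainLeaf_eq_sum_isolating_two :
    nestLeaf (R := R) ends o a₁ a₂ a₃ b s₁ s₂ s₃ F₀ z₀ τ (false, true, true) =
      ∑ σ ∈ isolSet 2, patternWeight ends o a₁ a₂ a₃ b s₁ s₂ s₃ F₀ z₀ τ σ := by
  unfold nestLeaf
  rw [chainCoeff_one_one_one, isolSet_two, Finset.sum_insert (by decide),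
    Finset.sum_insert (by decide), Finset.sum_insert (by decide), Finset.sum_insert (by decide),
    Finset.sum_insert (by decide), Finset.sum_singleton]
  unfold patternWeight
  simp only [copyPat, pairPat, Matrix.cons_val_zero, Matrix.cons_val_one, Matrix.head_cons,
    Matrix.cons_val_two, Matrix.tail_cons, onCopy, orU, Bool.and_true, Bool.and_false,
    Bool.or_true, Bool.or_false]
  ring

/-- **The chain leaf `E_p = Λ(T;p;∅)` is the sum over the placements isolating `p`.** -/
theorem chainLeaf_eq_sum_isolating (i : Fin 3) :
    nestLeaf (R := R) ends o a₁ a₂ a₃ b s₁ s₂ s₃ F₀ z₀ τ (pairPat i) =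
      ∑ σ ∈ isolSet i, patternWeight ends o a₁ a₂ a₃ b s₁ s₂ s₃ F₀ z₀ τ σ := by
  fin_cases i
  · exact chainLeaf_eq_sum_isolating_zero ends o a₁ a₂ a₃ b s₁ s₂ s₃ F₀ z₀ τ
  · exact chainLeaf_eq_sum_isolating_one ends o a₁ a₂ a₃ b s₁ s₂ s₃ F₀ z₀ τ
  · exact chainLeaf_eq_sum_isolating_two ends o a₁ a₂ a₃ b s₁ s₂ s₃ F₀ z₀ τ

/-- **The antichain leaf `A = Λ(01;02;12)` is the sum over the injective placements.** -/
theorem antiLeaf_eq_sum_distinct :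
    antiCoeff (R := R) ends o a₁ a₂ a₃ b s₁ s₂ s₃ F₀ z₀ τ =
      ∑ σ ∈ distinctSet, patternWeight ends o a₁ a₂ a₃ b s₁ s₂ s₃ F₀ z₀ τ σ := by
  rw [antiCoeff_eq_Bthree, distinctSet_eq, Finset.sum_insert (by decide),
    Finset.sum_insert (by decide), Finset.sum_insert (by decide), Finset.sum_insert (by decide),
    Finset.sum_insert (by decide), Finset.sum_singleton]
  unfold patternWeight Bthree
  simp only [copyPat, pairPat, Matrix.cons_val_zero, Matrix.cons_val_one, Matrix.head_cons,
    Matrix.cons_val_two, Matrix.tail_cons, onCopy, orU, Bool.and_true, Bool.and_false,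
    Bool.or_true, Bool.or_false]
  ring

end Dictionary

section Rules

variable {V : Type*} {E : Type*} [Fintype E] [DecidableEq E] {R : Type*} [Field R] [LinearOrder R]
  [IsStrictOrderedRing R]

variable (ends : E → Sym2 V) (o a₁ a₂ a₃ b : V) (s₁ s₂ s₃ : E) (F₀ : Finset E) (z₀ : Config E)
  (τ : E → ℕ)

/-- **`TvT` in the dictionary**: `B(T₁) ≤ B(△₁) ↔ 0 ≤ A + Σ_p E_p`. -/
theorem tvT_iff :
    TvT (R := R) ends o a₁ a₂ a₃ b s₁ s₂ s₃ F₀ z₀ τ ↔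
      0 ≤ antiCoeff (R := R) ends o a₁ a₂ a₃ b s₁ s₂ s₃ F₀ z₀ τ +
        (nestLeaf ends o a₁ a₂ a₃ b s₁ s₂ s₃ F₀ z₀ τ (pairPat 0) +
          nestLeaf ends o a₁ a₂ a₃ b s₁ s₂ s₃ F₀ z₀ τ (pairPat 1) +
          nestLeaf ends o a₁ a₂ a₃ b s₁ s₂ s₃ F₀ z₀ τ (pairPat 2)) := by
  unfold TvT
  rw [Btriangle_eq]
  simp only [pairPat, Matrix.cons_val_zero, Matrix.cons_val_one, Matrix.head_cons,
    Matrix.cons_val_two, Matrix.tail_cons]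
  constructor
  · intro h; linarith
  · intro h; linarith

/-- **`Pay222` in the dictionary**: `∃ p, 0 ≤ A + E_p`. -/
theorem pay222_iff :
    Pay222 (R := R) ends o a₁ a₂ a₃ b s₁ s₂ s₃ F₀ z₀ τ ↔
      ∃ i : Fin 3, 0 ≤ antiCoeff (R := R) ends o a₁ a₂ a₃ b s₁ s₂ s₃ F₀ z₀ τ +
        nestLeaf ends o a₁ a₂ a₃ b s₁ s₂ s₃ F₀ z₀ τ (pairPat i) := by
  rw [pay222_iff_exists]
  constructor
  · rintro ⟨p, hp, h⟩
    simp only [placements2, Finset.mem_insert, Finset.mem_singleton] at hp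
    rcases hp with rfl | rfl | rfl
    · exact ⟨0, h⟩
    · exact ⟨1, h⟩
    · exact ⟨2, h⟩
  · rintro ⟨i, h⟩
    fin_cases i
    · simp only [Fin.zero_eta, pairPat, Matrix.cons_val_zero] at h
      exact ⟨(true, true, false), by simp [placements2], h⟩
    · simp only [Fin.mk_one, pairPat, Matrix.cons_val_one, Matrix.cons_val_zero] at h
      exact ⟨(true, false, true), by simp [placements2], h⟩
    · simp only [Fin.reduceFinMk, pairPat, Matrix.cons_val_two, Matrix.tail_cons,
        Matrix.head_cons] at h
      exact ⟨(false, true, true), by simp [placements2], h⟩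

omit [IsStrictOrderedRing R] in
/-- **The two-largest rule — the payment target of record** (ASSIGNMENTS v12.32 (0′)): for some two
distinct pairs `q ≠ r` of the triple, `0 ≤ Λ(01;02;12) + E(T;q) + E(T;r)`
(`⟺ B(△₁) ≥ min_p B(T₁ + p₁)`, `twoLargest_iff_min`). A definition only. SCOPE: conjectured for
every typed GRAPH instance with ONE star at `y`, ends arbitrary (NEG-109: the one-leaf form
`Pay222` is false when an end is unmarked; `Pay222` holds on the five-mark censuses, ends = marks);
never for typed hypergraphs with unmarked vertices (NEG-108). -/
def TwoLargest : Prop :=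
  (0 ≤ antiCoeff (R := R) ends o a₁ a₂ a₃ b s₁ s₂ s₃ F₀ z₀ τ +
      (nestLeaf ends o a₁ a₂ a₃ b s₁ s₂ s₃ F₀ z₀ τ (pairPat 1) +
        nestLeaf ends o a₁ a₂ a₃ b s₁ s₂ s₃ F₀ z₀ τ (pairPat 2))) ∨
  (0 ≤ antiCoeff (R := R) ends o a₁ a₂ a₃ b s₁ s₂ s₃ F₀ z₀ τ +
      (nestLeaf ends o a₁ a₂ a₃ b s₁ s₂ s₃ F₀ z₀ τ (pairPat 0) +
        nestLeaf ends o a₁ a₂ a₃ b s₁ s₂ s₃ F₀ z₀ τ (pairPat 2))) ∨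
  (0 ≤ antiCoeff (R := R) ends o a₁ a₂ a₃ b s₁ s₂ s₃ F₀ z₀ τ +
      (nestLeaf ends o a₁ a₂ a₃ b s₁ s₂ s₃ F₀ z₀ τ (pairPat 0) +
        nestLeaf ends o a₁ a₂ a₃ b s₁ s₂ s₃ F₀ z₀ τ (pairPat 1)))

/-- **The two-largest rule is `min_p B(T₁ + p₁) ≤ B(△₁)`** (the lead's symmetric form). -/
theorem twoLargest_iff_min :
    TwoLargest (R := R) ends o a₁ a₂ a₃ b s₁ s₂ s₃ F₀ z₀ τ ↔
      min (Btwo (R := R) ends o a₁ a₂ a₃ b s₁ s₂ s₃ F₀ z₀ τ (pairPat 0) (true, true, true))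
        (min (Btwo ends o a₁ a₂ a₃ b s₁ s₂ s₃ F₀ z₀ τ (pairPat 1) (true, true, true))
          (Btwo ends o a₁ a₂ a₃ b s₁ s₂ s₃ F₀ z₀ τ (pairPat 2) (true, true, true))) ≤
      Btriangle ends o a₁ a₂ a₃ b s₁ s₂ s₃ F₀ z₀ τ := by
  unfold TwoLargest
  rw [Btriangle_eq, Btwo_eq_Bone_add_nestLeaf, Btwo_eq_Bone_add_nestLeaf,
    Btwo_eq_Bone_add_nestLeaf, min_le_iff, min_le_iff]
  simp only [pairPat, Matrix.cons_val_zero, Matrix.cons_val_one, Matrix.head_cons,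
    Matrix.cons_val_two, Matrix.tail_cons]
  constructor
  · rintro (h | h | h)
    · left; linarith
    · right; left; linarith
    · right; right; linarith
  · rintro (h | h | h)
    · left; linarith
    · right; left; linarith
    · right; right; linarith

/-- **`Pay222 ∧ TriCH ⟹ TwoLargest`**: the paying pair's leaf plus any other chain leaf. -/
theorem twoLargest_of_pay222_of_triCH
    (hP : Pay222 (R := R) ends o a₁ a₂ a₃ b s₁ s₂ s₃ F₀ z₀ τ)
    (hCH : TriCH (R := R) ends o a₁ a₂ a₃ b s₁ s₂ s₃ F₀ z₀ τ) :
    TwoLargest (R := R) ends o a₁ a₂ a₃ b s₁ s₂ s₃ F₀ z₀ τ := by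
  unfold TwoLargest
  obtain ⟨h1, h2, h3⟩ := nestLeaf_nonneg_of_triCH ends o a₁ a₂ a₃ b s₁ s₂ s₃ F₀ z₀ τ hCH
  rcases (pay222_iff ends o a₁ a₂ a₃ b s₁ s₂ s₃ F₀ z₀ τ).1 hP with ⟨i, h⟩
  simp only [pairPat, Matrix.cons_val_zero, Matrix.cons_val_one, Matrix.head_cons,
    Matrix.cons_val_two, Matrix.tail_cons] at h1 h2 h3 ⊢
  fin_cases i
  · simp only [Fin.zero_eta, pairPat, Matrix.cons_val_zero] at h
    right; left; linarith
  · simp only [Fin.mk_one, pairPat, Matrix.cons_val_one, Matrix.cons_val_zero] at h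
    left; linarith
  · simp only [Fin.reduceFinMk, pairPat, Matrix.cons_val_two, Matrix.tail_cons,
      Matrix.head_cons] at h
    left; linarith

/-- **`TwoLargest ∧ TriCH ⟹ TvT`**: add the remaining chain leaf. -/
theorem tvT_of_twoLargest_of_triCH
    (hT : TwoLargest (R := R) ends o a₁ a₂ a₃ b s₁ s₂ s₃ F₀ z₀ τ)
    (hCH : TriCH (R := R) ends o a₁ a₂ a₃ b s₁ s₂ s₃ F₀ z₀ τ) :
    TvT (R := R) ends o a₁ a₂ a₃ b s₁ s₂ s₃ F₀ z₀ τ := by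
  rw [tvT_iff]
  unfold TwoLargest at hT
  obtain ⟨h1, h2, h3⟩ := nestLeaf_nonneg_of_triCH ends o a₁ a₂ a₃ b s₁ s₂ s₃ F₀ z₀ τ hCH
  simp only [pairPat, Matrix.cons_val_zero, Matrix.cons_val_one, Matrix.head_cons,
    Matrix.cons_val_two, Matrix.tail_cons] at hT ⊢
  rcases hT with h | h | h <;> linarith

variable {ends} {o a₁ a₂ a₃ b} {s₁ s₂ s₃} {F₀} {z₀} {τ} {y u₁ u₂ u₃ : V}

/-- **The chain of record in the kernel**: `TwoLargest ∧ TriCH` (one rung down) `⟹ 0 ≤ N_(2,2,2)`. -/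
theorem typedCount_222_nonneg_of_twoLargest_of_triCH (F : Finset E) (z : Config E) (τ : E → ℕ)
    (D : StarData ends o a₁ a₂ a₃ b s₁ s₂ s₃ y u₁ u₂ u₃ (((F.erase s₁).erase s₂).erase s₃)
      (Function.update (Function.update (Function.update z s₁ false) s₂ false) s₃ false))
    (hs₁ : s₁ ∈ F) (hs₂ : s₂ ∈ F) (hs₃ : s₃ ∈ F) (hτ₁ : τ s₁ = 2) (hτ₂ : τ s₂ = 2)
    (hτ₃ : τ s₃ = 2)
    (hT : TwoLargest (R := R) ends o a₁ a₂ a₃ b s₁ s₂ s₃ (((F.erase s₁).erase s₂).erase s₃)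
      (Function.update (Function.update (Function.update z s₁ false) s₂ false) s₃ false) τ)
    (hCH : TriCH (R := R) ends o a₁ a₂ a₃ b s₁ s₂ s₃ (((F.erase s₁).erase s₂).erase s₃)
      (Function.update (Function.update (Function.update z s₁ false) s₂ false) s₃ false) τ) :
    0 ≤ typedCount F z τ (K3 ends o a₁ a₂ a₃ b : Config E → Config E → Config E → R) :=
  typedCount_222_nonneg_of_tvT_of_triCH F z τ D hs₁ hs₂ hs₃ hτ₁ hτ₂ hτ₃
    (tvT_of_twoLargest_of_triCH ends o a₁ a₂ a₃ b s₁ s₂ s₃ _ _ τ hT hCH) hCH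

end Rules

end StarPattern

end Summit.Ventures.PercRepro2
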